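import Summits.ResolutionOfSingularities.ResolutionOfSingularities.Theorems.FrobeniusLadderFRationalResolutionRechartStep
import HarnessLib

/-!
# Crux `FrobeniusLadder.FRationalResolution` (stmt-ResolutionOfSingularities-15317), line `redirect`,
# stub `stub_diagonalizableQuotientResolution` — item (F2) SETTLED: EVERY point of EVERY quotient chart of the stub's shape is the image of a
# FIXED point of a quotient chart of the same shape (no tameness, no perfectness: wild diagonalizable stabilisers included)

By induction on the order of the unit-degree subgroup `B` of a prime over the point: `B = 0` means the point is fixed; otherwise the
re-charting step `…RechartStep.exists_rechart_card_lt` (root adjunction along a degree `b ∈ B ∖ ℓ·B` in the pushout grading group,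
then split-off) produces a chart of the same shape through the same point of `X` with a strictly smaller unit-degree subgroup.

* ★★★★★ `exists_fixed_rechart` — chart `(A, S, 𝒮, φ)` of the stub's shape (`S` regular of finite type over the field `k`, graded by
  the finite abelian group `A`, `φ : Spec S₀ → X` étale, compatible with the structure maps) and a point `v` of `Spec S₀` ⇒ a chart
  `(A', S', 𝒮', φ')` of the same shape, a point `v'` with `φ' v' = φ v` and a prime `𝔔'` of `S'` over `v'` which is FIXED:
  `S'_c ⊆ 𝔔'` for all `c ≠ 0`.

Consequently the hypothesis `hq` of `stub_diagonalizableQuotientResolution` may be assumed to present every point of `X` as the image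
of a `D(A)`-FIXED point (MEMO-15317-leafhand2-g20/21 item (F2)); what remains of the stub is the resolution at fixed points
(`…FixedPoint*`, toric certificates (F3)) and the non-isolated case (F4). Honest label: helper toward ONE leaf stub; no stub, crux or
summit closed. No definitions, no named facts, no sorry. [folklore; cite: SGA3, Exp. VIII §4–5]
[cite: Matsumura1987, Thm. 14.2; §25; §30, Cor. to Thm. 30.5] [cite: StacksProject, Tag 07NG]
-/

noncomputable section

-- single-problem summit: the doubled namespace component is forced
set_option linter.dupNamespace false

open CategoryTheory AlgebraicGeometry
open Literature.AlgebraicGeometry.Resolution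

namespace Summit.ResolutionOfSingularities.ResolutionOfSingularities.Theorems.FRationalResolution.FixedRechart

/-- The induction on the order of the unit-degree subgroup. [folklore; cite: SGA3, Exp. VIII §4–5] -/
theorem exists_fixed_rechart_of_card_le (k : Type) [Field k] (X : Scheme.{0}) (g : X ⟶ Spec (.of k)) (N : ℕ) :
    ∀ (A : Type) [AddCommGroup A] [Finite A] [DecidableEq A] (S : Type) [CommRing S] [Algebra k S]
      (𝒮 : A → Submodule k S) [GradedAlgebra 𝒮] [Algebra.FiniteType k S] [IsRegularRing S]
      (φ : Spec (.of (𝒮 0)) ⟶ X) [Etale φ]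
      (_ : φ ≫ g = Spec.map (CommRingCat.ofHom (algebraMap k (𝒮 0))))
      (v : Spec (.of (𝒮 0))) (𝔔 : Ideal S) [𝔔.IsPrime] (_ : 𝔔.comap (algebraMap (𝒮 0) S) = v.asIdeal)
      (B : AddSubgroup A) (_ : ∀ i : A, i ∈ B ↔ ∃ s ∈ 𝒮 i, s ∉ 𝔔) (_ : Nat.card B ≤ N),
    ∃ (A' : Type) (_ : AddCommGroup A') (_ : Finite A') (_ : DecidableEq A')
      (S' : Type) (_ : CommRing S') (_ : Algebra k S') (𝒮' : A' → Submodule k S') (_ : GradedAlgebra 𝒮'),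
      Algebra.FiniteType k S' ∧ IsRegularRing S' ∧
      ∃ (φ' : Spec (.of (𝒮' 0)) ⟶ X), Etale φ' ∧
        φ' ≫ g = Spec.map (CommRingCat.ofHom (algebraMap k (𝒮' 0))) ∧
        ∃ (v' : Spec (.of (𝒮' 0))) (𝔔' : Ideal S') (_ : 𝔔'.IsPrime),
          𝔔'.comap (algebraMap (𝒮' 0) S') = v'.asIdeal ∧
          (∀ c : A', c ≠ 0 → ∀ s ∈ 𝒮' c, s ∈ 𝔔') ∧ φ' v' = φ v := by
  induction N with
  | zero =>
    intro A _ _ _ S _ _ 𝒮 _ _ _ φ _ hφg v 𝔔 _ h𝔔v B hB hN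
    exact absurd hN (not_le.2 Nat.card_pos)
  | succ N ih =>
    intro A _ _ _ S _ _ 𝒮 _ _ _ φ _ hφg v 𝔔 _ h𝔔v B hB hN
    by_cases hB0 : B = ⊥
    · -- the point is already fixed
      refine ⟨A, inferInstance, inferInstance, inferInstance, S, inferInstance, inferInstance, 𝒮, inferInstance, inferInstance,
        inferInstance, φ, inferInstance, hφg, v, 𝔔, inferInstance, h𝔔v, fun c hc s hs => ?_, rfl⟩
      by_contra h
      exact hc (by have := (hB c).2 ⟨s, hs, h⟩; rwa [hB0, AddSubgroup.mem_bot] at this)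
    · obtain ⟨A', iA', fA', dA', S', iS', aS', 𝒮', inst𝒮', hft', hreg', φ', hφ'et, hφ'g, v', 𝔔', h𝔔'p, h𝔔'v', B', hB', hlt,
        hφ'v⟩ := RechartStep.exists_rechart_card_lt k X g A S 𝒮 φ hφg v 𝔔 h𝔔v B hB hB0
      letI := iA'; letI := fA'; letI := dA'; letI := iS'; letI := aS'; letI := inst𝒮'
      haveI := hft'; haveI := hreg'; haveI := hφ'et; haveI := h𝔔'p
      obtain ⟨A'', i1, i2, i3, S'', i4, i5, 𝒮'', i6, hft'', hreg'', φ'', hφ''et, hφ''g, v'', 𝔔'', h𝔔''p, h𝔔''v'', hfix, hφ''v⟩ :=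
        ih A' S' 𝒮' φ' hφ'g v' 𝔔' h𝔔'v' B' hB' (by omega)
      exact ⟨A'', i1, i2, i3, S'', i4, i5, 𝒮'', i6, hft'', hreg'', φ'', hφ''et, hφ''g, v'', 𝔔'', h𝔔''p, h𝔔''v'', hfix,
        hφ''v.trans hφ'v⟩

/-- ★★★★★ **Item (F2): every point of every quotient chart re-charts to a FIXED point.** See the module docstring.
[folklore; cite: SGA3, Exp. VIII §4–5] [cite: Matsumura1987, Thm. 14.2; §25; §30, Cor. to Thm. 30.5] [cite: StacksProject, Tag 07NG] -/
theorem exists_fixed_rechart (k : Type) [Field k] (X : Scheme.{0}) (g : X ⟶ Spec (.of k))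
    (A : Type) [AddCommGroup A] [Finite A] [DecidableEq A] (S : Type) [CommRing S] [Algebra k S]
    (𝒮 : A → Submodule k S) [GradedAlgebra 𝒮] [Algebra.FiniteType k S] [IsRegularRing S]
    (φ : Spec (.of (𝒮 0)) ⟶ X) [Etale φ]
    (hφg : φ ≫ g = Spec.map (CommRingCat.ofHom (algebraMap k (𝒮 0)))) (v : Spec (.of (𝒮 0))) :
    ∃ (A' : Type) (_ : AddCommGroup A') (_ : Finite A') (_ : DecidableEq A')
      (S' : Type) (_ : CommRing S') (_ : Algebra k S') (𝒮' : A' → Submodule k S') (_ : GradedAlgebra 𝒮'),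
      Algebra.FiniteType k S' ∧ IsRegularRing S' ∧
      ∃ (φ' : Spec (.of (𝒮' 0)) ⟶ X), Etale φ' ∧
        φ' ≫ g = Spec.map (CommRingCat.ofHom (algebraMap k (𝒮' 0))) ∧
        ∃ (v' : Spec (.of (𝒮' 0))) (𝔔' : Ideal S') (_ : 𝔔'.IsPrime),
          𝔔'.comap (algebraMap (𝒮' 0) S') = v'.asIdeal ∧
          (∀ c : A', c ≠ 0 → ∀ s ∈ 𝒮' c, s ∈ 𝔔') ∧ φ' v' = φ v := by
  classical
  have hA : AddMonoid.IsTorsion A := fun i => isOfFinAddOrder_of_finite i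
  -- a prime of `S` over `v`
  haveI : Algebra.IsIntegral (𝒮 0) S := DiagonalizableQuotient.algebra_isIntegral 𝒮 hA
  haveI : v.asIdeal.IsPrime := v.isPrime
  have hker : (⊥ : Ideal S).comap (algebraMap (𝒮 0) S) ≤ v.asIdeal := by
    rw [Ideal.comap_bot_of_injective _ (DiagonalizableQuotient.algebraMap_gradeZero_injective 𝒮)]
    exact bot_le
  obtain ⟨𝔔, -, h𝔔p, h𝔔v⟩ := Ideal.exists_ideal_over_prime_of_isIntegral v.asIdeal ⊥ hker
  haveI := h𝔔p
  obtain ⟨B, hB, -⟩ := StabilizerSubgroup.exists_unitDegrees_addSubgroup 𝒮 hA 𝔔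
  exact exists_fixed_rechart_of_card_le k X g (Nat.card B) A S 𝒮 φ hφg v 𝔔 h𝔔v B hB le_rfl

end Summit.ResolutionOfSingularities.ResolutionOfSingularities.Theorems.FRationalResolution.FixedRechart

end
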